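import Mathlib
import Summits.Ventures.HodgeRepro.Tier4.Target
import Summits.Ventures.HodgeRepro.Tier4.Line3.Defs
import Summits.Ventures.HodgeRepro.Tier4.Line3.DefsLemmas
import Summits.Ventures.HodgeRepro.Tier4.Line3.LocaliserS
import Summits.Ventures.HodgeRepro.Tier4.Line3.GramCongruence
import Summits.Ventures.HodgeRepro.Tier4.Line3.ConjCongruence
import Summits.Ventures.HodgeRepro.Tier4.Line3.Denominator
import Summits.Ventures.HodgeRepro.Tier4.Line3.OffMainOrbit
import Summits.Ventures.HodgeRepro.Tier4.Line3.ClassBoundGauss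
import Summits.Ventures.HodgeRepro.Tier4.Line3.RayMinor

/-!
# Tier4/Line3/CrossMinor — PER-SLOT scalar copies and the DEGREE-4 invariants (the cross minor rung)

Blind re-derivation cell `pub-hodge-repro`, Tier 4 «PROVE THE STEP» (README §9–§10), LINE L3, lemma L3.5
`term_dominated`; seat t4-L2-p3 (gen 3).  The scalar symmetry of the coefficient system acts PER SLOT
(t4-x2 g2 S13421 (2), t4-crit-1 g3 S13433): the honest support clause puts a supported tuple in the deep ball around
a per-slot copy `(λ₀ xm₀, …, λ₃ xm₃)`, and the one-scalar `SuppU` / `GramRay` / 2×2 minor of `RayMinor` are the special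
case `λ₀ = … = λ₃`.  This module is the per-slot successor of `RayMinor`'s rung, structure-independent:

* `SuppSlot D p xm loc` — x2's (2) text: every supported line tuple has a representative `x` with
  `x j − λ j • xm j ∈ (𝔭𝔭̄)^N L`, `λ j ≠ 0`, `λ j • xm j ∈ L`, `L ∈ S` finite;
* `crossMinor xm x i j k l = G_ij(x) G_kl(x) G_il G_kj − G_il(x) G_kj(x) G_ij G_kl` (`G = Gram(xm)`), the degree-4
  invariant in which the rank-one twist `c(λ_i) λ_j` of a per-slot copy CANCELS;
* `crossModule L xm = h(L,L)·h(L,L)·span(G)·span(G)` (finitely generated);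
* **`crossMinor_mem`**: for `x j ≡ λ j • xm j mod (𝔭𝔭̄)^N L` with `λ j • xm j ∈ L`,
  `crossMinor xm x i j k l ∈ (𝔭𝔭̄)^N • crossModule L xm` (`Gram(x) = D^* G D + E`, `E ∈ (𝔭𝔭̄)^N • h(L,L)`, the twisted
  part cancels, every remaining term is `E × (an entry of Gram(x)) × G × G`);
* `norm_crossMinor_le`: a large cross minor forces a large Gram entry of `x` among the four involved;
* **`exists_crossMinor_size`**: ONE `D₀ ≠ 0` for all depths with `N(𝔭)^N ≤ ‖σ D₀‖^d ‖σ M_{ijkl}‖^d` at some embedding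
  for every supported tuple with a NON-ZERO cross minor (the characterisation «off the scalar family ⇒ some cross minor
  is non-zero» is the planner's (R3″) and is consumed by name when typed).

No printed input is consumed; nothing here asserts anything about the truth of (P); HC_CM is NOT proved by anyone
in this repository.
-/

set_option autoImplicit false

noncomputable section

namespace Summit.Ventures.HodgeRepro.Tier4.Line3

open Summit.Ventures.HodgeRepro.Tier4
open Matrix NumberField

/-! ### 0. Products with one smeared factor, on either side -/

section MulMem

variable {R : Type*} [CommRing R] {E : Type*} [CommRing E] [Algebra R E]

/-- `u * v ∈ I • map₂ (·*·) M₁ M₂` when `u ∈ M₁` and `v ∈ I • M₂`. -/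
theorem mul_mem_smul_map₂_mul' {I : Ideal R} {M₁ M₂ : Submodule R E} {u v : E} (hu : u ∈ M₁) (hv : v ∈ I • M₂) :
    u * v ∈ I • Submodule.map₂ (LinearMap.mul R E) M₁ M₂ := by
  refine Submodule.smul_induction_on hv (fun r hr n hn => ?_) (fun a b ha hb => ?_)
  · rw [mul_smul_comm]
    exact Submodule.smul_mem_smul hr (Submodule.apply_mem_map₂ _ hu hn)
  · rw [mul_add]
    exact Submodule.add_mem _ ha hb

/-- `u * v ∈ map₂ (·*·) M₁ M₂` when `u ∈ M₁` and `v ∈ M₂`. -/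
theorem mul_mem_map₂_mul {M₁ M₂ : Submodule R E} {u v : E} (hu : u ∈ M₁) (hv : v ∈ M₂) :
    u * v ∈ Submodule.map₂ (LinearMap.mul R E) M₁ M₂ :=
  Submodule.apply_mem_map₂ _ hu hv

end MulMem

namespace T4Data

variable (X : T4Data)

/-! ### 1. The per-slot support clause -/

/-- **THE PER-SLOT SCALAR-COPY SUPPORT CLAUSE** (t4-x2 g2 S13421 (2)): every line tuple carrying a non-zero
coefficient of the depth-`N` localiser has a representative in the depth-`N` ball around a PER-SLOT scalar copy
`(λ₀ xm₀, …, λ₃ xm₃) ∈ L⁴` of the main tuple, `L ∈ S`. -/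
def SuppSlot (D : X.ThetaData) (p : IsDedekindDomain.HeightOneSpectrum (RingOfIntegers X.E)) (xm : X.Tuple)
    {level : ℕ → X.Level} (loc : ∀ N, X.Tr (level N)) : Prop :=
  ∃ S : Finset (Submodule (RingOfIntegers X.E) (Fin 3 → X.E)),
    (∀ L ∈ S, X.IsLattice L ∧ ∀ j, xm j ∈ L) ∧
    ∀ N (w : X.LineTuple), X.coefQ D.cf (loc N) (X.rep w) ≠ 0 →
      ∃ (lam : Fin 4 → X.E) (x : X.Tuple) (L : Submodule (RingOfIntegers X.E) (Fin 3 → X.E)), L ∈ S ∧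
        (∀ j, lam j ≠ 0 ∧ lam j • xm j ∈ L ∧ x j - lam j • xm j ∈ (p.asIdeal * X.conjIdeal p.asIdeal) ^ N • L) ∧
        X.lines x = w

/-! ### 2. The Gram matrix of a per-slot copy and the congruence from the ball -/

/-- `Gram(λ • xm)_{ij} = c(λ_i) λ_j G_ij` for a per-slot copy. -/
theorem gram_slot_smul (xm : X.Tuple) (lam : Fin 4 → X.E) (i j : Fin 4) :
    X.gram (fun j => lam j • xm j) i j = X.c (lam i) * lam j * X.gram xm i j := by
  unfold gram
  exact X.hform_smul (lam i) (lam j) (xm i) (xm j)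

/-- **Gram congruence from a per-slot copy in the lattice**: `G_ij(x) − c(λ_i) λ_j G_ij ∈ (𝔭𝔭̄)^N • gramSpanL L xm`. -/
theorem gram_sub_slot_mem (p : IsDedekindDomain.HeightOneSpectrum (RingOfIntegers X.E)) (N : ℕ)
    (L : Submodule (RingOfIntegers X.E) (Fin 3 → X.E)) (xm x : X.Tuple) (lam : Fin 4 → X.E)
    (hl : ∀ j, lam j • xm j ∈ L) (hx : ∀ j, x j - lam j • xm j ∈ X.ballIdeal p N • L) (i j : Fin 4) :
    X.gram x i j - X.c (lam i) * lam j * X.gram xm i j ∈ X.ballIdeal p N • X.gramSpanL L xm := by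
  set xm' : X.Tuple := fun j => lam j • xm j with hxm'
  have hcx : ∀ j, conjVec X.c (x j - xm' j) ∈ X.ballIdeal p N • conjLattice X.c L := fun j =>
    conjVec_mem_smul_of_involutive X.c X.cR X.algebraMap_cR X.cR_cR p.asIdeal N L (hx j)
  have h1 := hform_sub_mem_smul X.c X.H (RingOfIntegers X.E) (X.ballIdeal p N) L (conjLattice X.c L) xm' x hx hcx i j
  have hspan : gramSpan X.c X.H (RingOfIntegers X.E) L (conjLattice X.c L) xm' ≤ X.gramSpanL L xm := by
    unfold gramSpan gramSpanL
    refine Submodule.map₂_le_map₂ ?_ ?_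
    · refine sup_le le_sup_left ?_
      refine (Submodule.span_le.mpr ?_).trans le_sup_left
      rintro _ ⟨j, rfl⟩
      exact conjVec_mem_conjLattice X.c (hl j)
    · refine sup_le le_sup_left ?_
      refine (Submodule.span_le.mpr ?_).trans le_sup_left
      rintro _ ⟨j, rfl⟩
      exact hl j
  have h2 := Submodule.smul_mono (le_refl (X.ballIdeal p N)) hspan h1
  have hG : hform X.c X.H (xm' i) (xm' j) = X.c (lam i) * lam j * X.gram xm i j := X.gram_slot_smul xm lam i j
  show hform X.c X.H (x i) (x j) - X.c (lam i) * lam j * X.gram xm i j ∈ _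
  rw [← hG]
  exact h2

/-- The Gram entries of a tuple in `L` lie in the Gram span of `L`. -/
theorem gram_mem_gramSpanL (L : Submodule (RingOfIntegers X.E) (Fin 3 → X.E)) (xm x : X.Tuple)
    (hx : ∀ j, x j ∈ L) (i j : Fin 4) : X.gram x i j ∈ X.gramSpanL L xm := by
  unfold gramSpanL gramSpan
  show bilH X.H (RingOfIntegers X.E) (conjVec X.c (x i)) (x j) ∈ _
  exact Submodule.apply_mem_map₂ _ ((le_sup_left : conjLattice X.c L ≤ _) (conjVec_mem_conjLattice X.c (hx i)))
    ((le_sup_left : L ≤ _) (hx j))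

/-- A tuple in the depth-`N` ball around a per-slot copy in `L` lies in `L`. -/
theorem mem_of_slot_ball (p : IsDedekindDomain.HeightOneSpectrum (RingOfIntegers X.E)) (N : ℕ)
    (L : Submodule (RingOfIntegers X.E) (Fin 3 → X.E)) (xm x : X.Tuple) (lam : Fin 4 → X.E)
    (hl : ∀ j, lam j • xm j ∈ L) (hx : ∀ j, x j - lam j • xm j ∈ X.ballIdeal p N • L) (j : Fin 4) : x j ∈ L := by
  have h1 : x j - lam j • xm j ∈ L := Submodule.smul_le_right (hx j)
  have h2 : x j = (x j - lam j • xm j) + lam j • xm j := by abel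
  rw [h2]
  exact L.add_mem h1 (hl j)

/-! ### 3. The cross minor and its module -/

/-- The degree-4 invariant `M_{ijkl}(x) = G_ij(x) G_kl(x) G_il G_kj − G_il(x) G_kj(x) G_ij G_kl` (`G = Gram(xm)`): the
rank-one twist `c(λ_i) λ_j` of a per-slot copy cancels in it. -/
def crossMinor (xm x : X.Tuple) (i j k l : Fin 4) : X.E :=
  X.gram x i j * X.gram x k l * X.gram xm i l * X.gram xm k j -
    X.gram x i l * X.gram x k j * X.gram xm i j * X.gram xm k l

/-- **The cross module** `gramSpanL·gramSpanL·span(G)·span(G)`. -/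
def crossModule (L : Submodule (RingOfIntegers X.E) (Fin 3 → X.E)) (xm : X.Tuple) :
    Submodule (RingOfIntegers X.E) X.E :=
  Submodule.map₂ (LinearMap.mul (RingOfIntegers X.E) X.E)
    (Submodule.map₂ (LinearMap.mul (RingOfIntegers X.E) X.E) (X.gramSpanL L xm) (X.gramSpanL L xm))
    (Submodule.map₂ (LinearMap.mul (RingOfIntegers X.E) X.E) (X.gramEntrySpan xm) (X.gramEntrySpan xm))

/-- The cross module of a finitely generated lattice is finitely generated. -/
theorem crossModule_fg {L : Submodule (RingOfIntegers X.E) (Fin 3 → X.E)} (hL : L.FG) (xm : X.Tuple) :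
    (X.crossModule L xm).FG :=
  Submodule.FG.map₂ _ (Submodule.FG.map₂ _ (X.gramSpanL_fg hL xm) (X.gramSpanL_fg hL xm))
    (Submodule.FG.map₂ _ (Submodule.fg_span (Set.finite_range _)) (Submodule.fg_span (Set.finite_range _)))

/-- A product `e · a · g · g'` with `e ∈ I • 𝔤`, `a ∈ 𝔤`, `g, g' ∈ 𝔤₀` lies in `I • crossModule`. -/
theorem smul_mul_mul_mul_mem_crossModule (L : Submodule (RingOfIntegers X.E) (Fin 3 → X.E)) (xm : X.Tuple)
    {I : Ideal (RingOfIntegers X.E)} {e a g g' : X.E} (he : e ∈ I • X.gramSpanL L xm) (ha : a ∈ X.gramSpanL L xm)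
    (hg : g ∈ X.gramEntrySpan xm) (hg' : g' ∈ X.gramEntrySpan xm) :
    e * a * g * g' ∈ I • X.crossModule L xm := by
  unfold crossModule
  have h1 := mul_mem_smul_map₂_mul he ha
  have h2 := mul_mem_map₂_mul (R := RingOfIntegers X.E) hg hg'
  have h3 := mul_mem_smul_map₂_mul h1 h2
  rw [show e * a * g * g' = e * a * (g * g') by ring]
  exact h3

/-- **THE CROSS-MINOR CONGRUENCE**: for `x j ≡ λ j • xm j mod (𝔭𝔭̄)^N L` with `λ j • xm j ∈ L`, every degree-4 invariant
lies in `(𝔭𝔭̄)^N • crossModule L xm`. -/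
theorem crossMinor_mem (p : IsDedekindDomain.HeightOneSpectrum (RingOfIntegers X.E)) (N : ℕ)
    (L : Submodule (RingOfIntegers X.E) (Fin 3 → X.E)) (xm x : X.Tuple) (lam : Fin 4 → X.E)
    (hl : ∀ j, lam j • xm j ∈ L) (hx : ∀ j, x j - lam j • xm j ∈ X.ballIdeal p N • L) (i j k l : Fin 4) :
    X.crossMinor xm x i j k l ∈ X.ballIdeal p N • X.crossModule L xm := by
  -- the entries of `Gram(x)` lie in the Gram span, the deviations in the smeared Gram span
  have hxL : ∀ j, x j ∈ L := X.mem_of_slot_ball p N L xm x lam hl hx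
  have hA : ∀ i j, X.gram x i j ∈ X.gramSpanL L xm := X.gram_mem_gramSpanL L xm x hxL
  have hE : ∀ i j, X.gram x i j - X.c (lam i) * lam j * X.gram xm i j ∈ X.ballIdeal p N • X.gramSpanL L xm :=
    X.gram_sub_slot_mem p N L xm x lam hl hx
  have hT : ∀ i j, X.c (lam i) * lam j * X.gram xm i j ∈ X.gramSpanL L xm := by
    intro i j
    have h := Submodule.sub_mem _ (hA i j) (Submodule.smul_le_right (hE i j))
    simpa using h
  have hG : ∀ i j, X.gram xm i j ∈ X.gramEntrySpan xm := X.gram_mem_gramEntrySpan xm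
  -- the identity: the twisted part cancels
  set A : Fin 4 → Fin 4 → X.E := fun i j => X.gram x i j with hAdef
  set T : Fin 4 → Fin 4 → X.E := fun i j => X.c (lam i) * lam j * X.gram xm i j with hTdef
  set e : Fin 4 → Fin 4 → X.E := fun i j => A i j - T i j with hedef
  have hid : X.crossMinor xm x i j k l =
      e i j * A k l * X.gram xm i l * X.gram xm k j + T i j * e k l * X.gram xm i l * X.gram xm k j -
      (e i l * A k j * X.gram xm i j * X.gram xm k l + T i l * e k j * X.gram xm i j * X.gram xm k l) := by
    simp only [crossMinor, hedef, hAdef, hTdef]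
    ring
  rw [hid]
  have hT' : ∀ i j, T i j ∈ X.gramSpanL L xm := hT
  have hA' : ∀ i j, A i j ∈ X.gramSpanL L xm := hA
  have he' : ∀ i j, e i j ∈ X.ballIdeal p N • X.gramSpanL L xm := hE
  refine Submodule.sub_mem _ (Submodule.add_mem _ ?_ ?_) (Submodule.add_mem _ ?_ ?_)
  · exact X.smul_mul_mul_mul_mem_crossModule L xm (he' i j) (hA' k l) (hG i l) (hG k j)
  · have h := X.smul_mul_mul_mul_mem_crossModule L xm (he' k l) (hT' i j) (hG i l) (hG k j)
    rw [show T i j * e k l * X.gram xm i l * X.gram xm k j = e k l * T i j * X.gram xm i l * X.gram xm k j by ring]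
    exact h
  · exact X.smul_mul_mul_mul_mem_crossModule L xm (he' i l) (hA' k j) (hG i j) (hG k l)
  · have h := X.smul_mul_mul_mul_mem_crossModule L xm (he' k j) (hT' i l) (hG i j) (hG k l)
    rw [show T i l * e k j * X.gram xm i j * X.gram xm k l = e k j * T i l * X.gram xm i j * X.gram xm k l by ring]
    exact h

/-! ### 4. A large cross minor forces a large Gram entry; the size rung -/

/-- `‖σ M_{ijkl}‖ ≤ G₀² (‖σ G_ij(x)‖ ‖σ G_kl(x)‖ + ‖σ G_il(x)‖ ‖σ G_kj(x)‖)` with `G₀ ≥ ‖σ G_ab‖` for all `a b`. -/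
theorem norm_crossMinor_le (xm x : X.Tuple) (σ : X.E →+* ℂ) {G₀ : ℝ} (hG₀0 : 0 ≤ G₀)
    (hG₀ : ∀ a b : Fin 4, ‖σ (X.gram xm a b)‖ ≤ G₀) (i j k l : Fin 4) :
    ‖σ (X.crossMinor xm x i j k l)‖ ≤
      G₀ ^ 2 * (‖σ (X.gram x i j)‖ * ‖σ (X.gram x k l)‖ + ‖σ (X.gram x i l)‖ * ‖σ (X.gram x k j)‖) := by
  unfold crossMinor
  rw [map_sub]
  refine (norm_sub_le _ _).trans ?_
  simp only [map_mul, norm_mul]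
  have h1 : ‖σ (X.gram x i j)‖ * ‖σ (X.gram x k l)‖ * ‖σ (X.gram xm i l)‖ * ‖σ (X.gram xm k j)‖ ≤
      ‖σ (X.gram x i j)‖ * ‖σ (X.gram x k l)‖ * G₀ * G₀ := by
    gcongr
    · exact hG₀ i l
    · exact hG₀ k j
  have h2 : ‖σ (X.gram x i l)‖ * ‖σ (X.gram x k j)‖ * ‖σ (X.gram xm i j)‖ * ‖σ (X.gram xm k l)‖ ≤
      ‖σ (X.gram x i l)‖ * ‖σ (X.gram x k j)‖ * G₀ * G₀ := by
    gcongr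
    · exact hG₀ i j
    · exact hG₀ k l
  calc ‖σ (X.gram x i j)‖ * ‖σ (X.gram x k l)‖ * ‖σ (X.gram xm i l)‖ * ‖σ (X.gram xm k j)‖ +
        ‖σ (X.gram x i l)‖ * ‖σ (X.gram x k j)‖ * ‖σ (X.gram xm i j)‖ * ‖σ (X.gram xm k l)‖
      ≤ ‖σ (X.gram x i j)‖ * ‖σ (X.gram x k l)‖ * G₀ * G₀ + ‖σ (X.gram x i l)‖ * ‖σ (X.gram x k j)‖ * G₀ * G₀ :=
        add_le_add h1 h2
    _ = G₀ ^ 2 * (‖σ (X.gram x i j)‖ * ‖σ (X.gram x k l)‖ + ‖σ (X.gram x i l)‖ * ‖σ (X.gram x k j)‖) := by ring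

/-- **THE CROSS-MINOR RUNG.** For a finite set `S` of finitely generated lattices there is ONE `D₀ ≠ 0` such that at
every depth `N`, for every tuple `x` in the ball around a per-slot copy `λ • xm ∈ L⁴` (`L ∈ S`) and every NON-ZERO cross
minor `M_{ijkl}(x)`, `N(𝔭)^N ≤ ‖σ D₀‖^d · ‖σ M_{ijkl}(x)‖^d` at some embedding `σ`. -/
theorem exists_crossMinor_size (p : IsDedekindDomain.HeightOneSpectrum (RingOfIntegers X.E))
    (S : Finset (Submodule (RingOfIntegers X.E) (Fin 3 → X.E))) (hS : ∀ L ∈ S, L.FG) (xm : X.Tuple) :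
    ∃ D₀ : RingOfIntegers X.E, D₀ ≠ 0 ∧ ∀ (N : ℕ) (lam : Fin 4 → X.E) (x : X.Tuple)
      (L : Submodule (RingOfIntegers X.E) (Fin 3 → X.E)), L ∈ S → (∀ j, lam j • xm j ∈ L) →
      (∀ j, x j - lam j • xm j ∈ X.ballIdeal p N • L) → ∀ i j k l : Fin 4, X.crossMinor xm x i j k l ≠ 0 →
      ∃ σ : X.E →+* ℂ, ((Ideal.absNorm p.asIdeal : ℝ) ^ N) ≤
        ‖σ D₀‖ ^ Module.finrank ℚ X.E * ‖σ (X.crossMinor xm x i j k l)‖ ^ Module.finrank ℚ X.E := by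
  obtain ⟨D₀, hD₀, hden⟩ := exists_denom_finset S (fun L => X.crossModule L xm) fun L hL => X.crossModule_fg (hS L hL) xm
  refine ⟨D₀, hD₀, fun N lam x L hL hl hx i j k l hne => ?_⟩
  have hmem : X.crossMinor xm x i j k l ∈ X.ballIdeal p N • X.crossModule L xm :=
    X.crossMinor_mem p N L xm x lam hl hx i j k l
  have hmem' : X.crossMinor xm x i j k l ∈ p.asIdeal ^ N • X.crossModule L xm :=
    Submodule.smul_mono_left (X.ballIdeal_le p N) hmem
  exact rung_archimedean_size_of_mem_smul X.E p N hD₀ (hden L hL) hmem' hne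

end T4Data

end Summit.Ventures.HodgeRepro.Tier4.Line3

end
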